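import Summits.Ventures.PackingBounds.Energy.GramDataCheck
import HarnessLib

/-!
# List-structural quadratic forms: the bridge between integer table data and explicit Gram forms

Framing: lottery ticket; floor = certified bounds/negative ranges. Venture `PackingBounds`, cell
`pub-packcert`, energy family E3PT (pub-packcert-energy gen 11; KERNEL-D6 route, the 'bridge' step).

`listQuad Y y` unfolds STRUCTURALLY (`simp only [listQuad, rowQuad, <data defs>]`, linear in the data, no index
lookups) to the explicit quadratic form `Σ_{i,j} (Y[i][j] : ℝ) · y i · y j`, which `ring` can compare with a
generated explicit Gram form; `listQuad_eq_sum_ent` identifies it ONCE AND FOR ALL with the `ent`-indexed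
double sum delivered by `GramData.psd_of_checks`. Together: PSD of an explicit Gram form from kernel-checked
integer data, with no quadratic-size tactic work.
-/

namespace Summit.Ventures.PackingBounds.Energy.GramData

open Finset

/-- `Σ_k (row[k] : ℝ) · y i · y (j0 + k)`, structurally in the list `row`. -/
def rowQuad (y : ℕ → ℝ) (i : ℕ) : List ℤ → ℕ → ℝ
  | [], _ => 0
  | c :: cs, j0 => (c : ℝ) * y i * y j0 + rowQuad y i cs (j0 + 1)

/-- `Σ_m rowQuad (Y[m]) (i0 + m)`, structurally in the list of rows. -/
def listQuad (y : ℕ → ℝ) : List (List ℤ) → ℕ → ℝ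
  | [], _ => 0
  | row :: rows, i0 => rowQuad y i0 row 0 + listQuad y rows (i0 + 1)

/-- `rowQuad` as an indexed sum. -/
theorem rowQuad_eq (y : ℕ → ℝ) (i : ℕ) :
    ∀ (row : List ℤ) (j0 : ℕ),
      rowQuad y i row j0 = ∑ k ∈ range row.length, (row.getD k 0 : ℝ) * y i * y (j0 + k)
  | [], j0 => by simp [rowQuad]
  | c :: cs, j0 => by
    rw [rowQuad, List.length_cons, Finset.sum_range_succ', rowQuad_eq y i cs (j0 + 1)]
    simp only [List.getD_cons_zero, List.getD_cons_succ, Nat.add_zero]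
    rw [add_comm]
    congr 1
    refine Finset.sum_congr rfl fun k _ => ?_
    rw [show j0 + 1 + k = j0 + (k + 1) by omega]

/-- `listQuad` as an indexed double sum. -/
theorem listQuad_eq (y : ℕ → ℝ) :
    ∀ (Y : List (List ℤ)) (i0 : ℕ),
      listQuad y Y i0 = ∑ m ∈ range Y.length,
        ∑ k ∈ range (Y.getD m []).length, ((Y.getD m []).getD k 0 : ℝ) * y (i0 + m) * y k
  | [], i0 => by simp [listQuad]
  | row :: rows, i0 => by
    rw [listQuad, List.length_cons, Finset.sum_range_succ', listQuad_eq y rows (i0 + 1), rowQuad_eq]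
    simp only [List.getD_cons_zero, List.getD_cons_succ, Nat.add_zero, Nat.zero_add]
    rw [add_comm]
    congr 1
    refine Finset.sum_congr rfl fun m _ => ?_
    rw [show i0 + 1 + m = i0 + (m + 1) by omega]

/-- **The bridge.** For an `r × r` table `Y` (all rows of length `r`), `listQuad y Y 0` is the `ent`-indexed
double sum `Σ_{i,j : Fin r} (ent Y i j : ℝ) · y i · y j` of `GramData.psd_of_checks`. -/
theorem listQuad_eq_sum_ent (y : ℕ → ℝ) (Y : List (List ℤ)) (r : ℕ) (hlen : Y.length = r)
    (hrow : ∀ m, m < r → (Y.getD m []).length = r) :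
    listQuad y Y 0 = ∑ i : Fin r, ∑ j : Fin r, (ent Y i j : ℝ) * y i * y j := by
  rw [listQuad_eq, hlen, Fin.sum_univ_eq_sum_range (fun i => ∑ j : Fin r, (ent Y i j : ℝ) * y i * y j) r]
  refine Finset.sum_congr rfl fun m hm => ?_
  rw [hrow m (Finset.mem_range.1 hm), Fin.sum_univ_eq_sum_range (fun j => (ent Y m j : ℝ) * y m * y j) r]
  refine Finset.sum_congr rfl fun k _ => ?_
  simp [ent]

end Summit.Ventures.PackingBounds.Energy.GramData
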